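import Mathlib.Analysis.Complex.Basic
import Mathlib.RingTheory.RootsOfUnity.PrimitiveRoots
import HarnessLib

set_option linter.dupNamespace false

/-!
# Route `route-ABC-IUTThetaPilot`, support item `GenEllTwo` (stmt-ABC-19679) — helper: torsion loci of
# the three power families on `ℙ¹ ∖ {0,1,∞}` meet pairwise exactly in the primitive sixth roots of unity

Elementary cyclotomic algebra (HELPER LEMMAS, `--supports stmt-ABC-19679`; not a closing theorem) used by
the "menu" of cusp-preserving Belyi self-maps of `ℙ¹` in the number-field-only route to [GenEll]
Thm. 2.1 (ii) ⇒ (i) for `(ℙ¹, {0,1,∞})` = the route decl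
`Summit.ABC.ABC.Theses.IUTThetaPilot.GenEllTwo` (route note of abc-iut-S6, `GENELLTWO-P1ROUTE.md`
§4 / §5 work package W8, "torsion-loci intersections"; package map consented by abc-iut-plan
2026-08-25). The three power families `γ = M⁻¹((M·)^p)`, `M ∈ S₃`, have torsion
(preperiodic) loci `T_{0∞} = μ_∞` (roots of unity), `T_{1∞} = 1 − μ_∞` and `T_{01} = μ_∞/(μ_∞ − 1)`
(the `S₃`-translates of `μ_∞` under `x ↦ 1 − x`, `x ↦ x/(x − 1)`). The covering lemma of W8 needs:
any two of these loci meet EXACTLY in the two primitive sixth roots of unity `e^{±iπ/3}` (hence no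
point lies on "many" loci), and a real root of unity is `±1`.

Contents (all PROVED, Mathlib only; in `ℂ`, and for an arbitrary field with a ring homomorphism to `ℂ`,
e.g. a number field with any complex embedding):

* `GenEllTwo.TorsionLoci.isPrimitiveRoot_six_iff` — in a field of characteristic zero,
  `IsPrimitiveRoot z 6 ↔ z ^ 2 - z + 1 = 0`;
* `GenEllTwo.TorsionLoci.sq_sub_add_one_eq_zero_iff_norm` — for `z : ℂ`, `z ^ 2 - z + 1 = 0 ↔ ‖z‖ = 1 ∧ ‖1 - z‖ = 1`;
* the three pairwise intersections: `isPrimitiveRoot_six_of_pow_eq_one_of_one_sub_pow_eq_one`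
  (`z ∈ μ_∞`, `1 − z ∈ μ_∞`), `isPrimitiveRoot_six_of_pow_eq_one_of_div_pow_eq_one` (`z ∈ μ_∞`,
  `z/(z−1) ∈ μ_∞`), `isPrimitiveRoot_six_of_one_sub_pow_eq_one_of_div_pow_eq_one` (`1 − z ∈ μ_∞`,
  `z/(z−1) ∈ μ_∞`), and their versions over a field `K` with `φ : K →+* ℂ`;
* the converse: for a primitive sixth root of unity `ζ`, `1 − ζ = ζ⁻¹ = ζ/(ζ − 1)`, so `ζ` lies on all
  three loci (`one_sub_eq_inv_of_sq_sub_add_one_eq_zero`, `div_sub_one_eq_inv_of_sq_sub_add_one_eq_zero`,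
  `isPrimitiveRoot_six_one_sub`, `isPrimitiveRoot_six_div_sub_one`);
* `GenEllTwo.TorsionLoci.eq_one_or_eq_neg_one_of_pow_eq_one_of_im_eq_zero` — a real root of unity in `ℂ` is `±1`;
* the Chebyshev torsion values: for `|u| = 1`, `u + u⁻¹ = 2 Re u` is real, lies in `[−2, 2]`, and
  equals `±2` only for `u = ±1` (`im_add_inv_eq_zero_of_norm_eq_one`, `abs_re_add_inv_le_two_of_norm_eq_one`,
  `eq_one_of_norm_eq_one_of_add_inv_eq_two`, `eq_neg_one_of_norm_eq_one_of_add_inv_eq_neg_two`).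

* `ne_of_pow_eq_of_pow_eq_of_not_isOfFinOrder` — for `a ≠ 0` not a root of unity, a `p`-th root and a
  `q`-th root of `a` (`p ≠ q`) are distinct (fresh roots are pairwise distinct across exponents).

What is NOT here: the Chebyshev families and their chart (owner of the menu: abc-iut-S6), heights,
Kronecker's theorem (Mathlib `NumberField.Embeddings.pow_eq_one_of_norm_eq_one`). Classical material;
nothing in this file touches [IUTchIII].
-/

namespace Summit.ABC.ABC.Theorems

namespace GenEllTwo.TorsionLoci

/-! ### The primitive sixth roots of unity in a field of characteristic zero -/

section Field

variable {K : Type*} [Field K]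

/-- In any field, a root of `X² − X + 1` satisfies `z³ = −1`. [folklore] -/
theorem pow_three_eq_neg_one_of_sq_sub_add_one_eq_zero {z : K} (h : z ^ 2 - z + 1 = 0) :
    z ^ 3 = -1 := by
  linear_combination (z + 1) * h

/-- In any field, a root of `X² − X + 1` satisfies `z⁶ = 1`. [folklore] -/
theorem pow_six_eq_one_of_sq_sub_add_one_eq_zero {z : K} (h : z ^ 2 - z + 1 = 0) : z ^ 6 = 1 := by
  have h3 := pow_three_eq_neg_one_of_sq_sub_add_one_eq_zero h
  calc z ^ 6 = (z ^ 3) ^ 2 := by ring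
    _ = 1 := by rw [h3]; ring

/-- In any field, a root of `X² − X + 1` is nonzero. [folklore] -/
theorem ne_zero_of_sq_sub_add_one_eq_zero {z : K} (h : z ^ 2 - z + 1 = 0) : z ≠ 0 := by
  rintro rfl
  norm_num at h

/-- For a root `ζ` of `X² − X + 1` one has `1 − ζ = ζ⁻¹` (the identity behind "`e^{±iπ/3}` lies on
both `μ_∞` and `1 − μ_∞`"). [folklore] -/
theorem one_sub_eq_inv_of_sq_sub_add_one_eq_zero {z : K} (h : z ^ 2 - z + 1 = 0) : 1 - z = z⁻¹ := by
  exact eq_inv_of_mul_eq_one_left (by linear_combination (-1 : K) * h)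

/-- For a root `ζ` of `X² − X + 1` one has `ζ/(ζ − 1) = ζ⁻¹` (the identity behind "`e^{±iπ/3}` lies on
both `μ_∞` and `μ_∞/(μ_∞ − 1)`"). [folklore] -/
theorem div_sub_one_eq_inv_of_sq_sub_add_one_eq_zero {z : K} (h : z ^ 2 - z + 1 = 0) :
    z / (z - 1) = z⁻¹ := by
  have hz := ne_zero_of_sq_sub_add_one_eq_zero h
  have h1 : z - 1 = z ^ 2 := by linear_combination (-1 : K) * h
  rw [h1, div_eq_iff (pow_ne_zero 2 hz), sq, ← mul_assoc, inv_mul_cancel₀ hz, one_mul]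

/-- A primitive sixth root of unity is a root of `X² − X + 1` (in any field): `ζ⁶ = 1`, `ζ³ ≠ 1`
forces `ζ³ = −1`, and `ζ² ≠ 1` excludes `ζ = −1` in `ζ³ + 1 = (ζ + 1)(ζ² − ζ + 1)`. [folklore] -/
theorem sq_sub_add_one_eq_zero_of_isPrimitiveRoot_six {z : K} (h : IsPrimitiveRoot z 6) :
    z ^ 2 - z + 1 = 0 := by
  have h6 : z ^ 6 = 1 := h.pow_eq_one
  have h3ne : z ^ 3 ≠ 1 := h.pow_ne_one_of_pos_of_lt (by norm_num) (by norm_num)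
  have h2ne : z ^ 2 ≠ 1 := h.pow_ne_one_of_pos_of_lt (by norm_num) (by norm_num)
  have hfac : (z ^ 3 - 1) * (z ^ 3 + 1) = 0 := by linear_combination h6
  have h3 : z ^ 3 + 1 = 0 := by
    rcases mul_eq_zero.mp hfac with h0 | h0
    · exact absurd (sub_eq_zero.mp h0) h3ne
    · exact h0
  have hfac2 : (z + 1) * (z ^ 2 - z + 1) = 0 := by linear_combination h3
  rcases mul_eq_zero.mp hfac2 with h0 | h0
  · exfalso
    apply h2ne
    have hz : z = -1 := by linear_combination h0
    rw [hz]; norm_num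
  · exact h0

/-- A primitive sixth root of unity `ζ` has `1 − ζ = ζ⁻¹`; in particular `1 − ζ` is again a primitive
sixth root of unity, i.e. `ζ ∈ T_{1∞} = 1 − μ_∞`. [folklore] -/
theorem isPrimitiveRoot_six_one_sub {z : K} (h : IsPrimitiveRoot z 6) : IsPrimitiveRoot (1 - z) 6 := by
  rw [one_sub_eq_inv_of_sq_sub_add_one_eq_zero (sq_sub_add_one_eq_zero_of_isPrimitiveRoot_six h)]
  exact h.inv

/-- A primitive sixth root of unity `ζ` has `ζ/(ζ − 1) = ζ⁻¹`; in particular `ζ/(ζ − 1)` is again a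
primitive sixth root of unity, i.e. `ζ ∈ T_{01} = μ_∞/(μ_∞ − 1)`. [folklore] -/
theorem isPrimitiveRoot_six_div_sub_one {z : K} (h : IsPrimitiveRoot z 6) :
    IsPrimitiveRoot (z / (z - 1)) 6 := by
  rw [div_sub_one_eq_inv_of_sq_sub_add_one_eq_zero (sq_sub_add_one_eq_zero_of_isPrimitiveRoot_six h)]
  exact h.inv

variable [CharZero K]

/-- In characteristic zero, a root of `X² − X + 1` is a PRIMITIVE sixth root of unity (the powers
`ζ, ζ², ζ³ = −1, ζ⁴ = −ζ, ζ⁵ = 1 − ζ` are `≠ 1` since `1, 2, 3 ≠ 0`). [folklore] -/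
theorem isPrimitiveRoot_six_of_sq_sub_add_one_eq_zero {z : K} (h : z ^ 2 - z + 1 = 0) :
    IsPrimitiveRoot z 6 := by
  have h3 := pow_three_eq_neg_one_of_sq_sub_add_one_eq_zero h
  refine (IsPrimitiveRoot.iff (by norm_num)).2 ⟨pow_six_eq_one_of_sq_sub_add_one_eq_zero h, ?_⟩
  intro l hl0 hl6 hl
  interval_cases l
  · rw [pow_one] at hl
    rw [hl] at h
    norm_num at h
  · have hz : z = 2 := by linear_combination (-1 : K) * h + hl
    rw [hz] at hl
    norm_num at hl
  · have h2 : (2 : K) = 0 := by linear_combination h3 - hl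
    norm_num at h2
  · have hz : z = -1 := by linear_combination (-1 : K) * hl + z * h3
    rw [hz] at h
    norm_num at h
  · have hz : z = 0 := by linear_combination z ^ 2 * h3 - h - hl
    rw [hz] at h
    norm_num at h

/-- **Primitive sixth roots of unity = roots of `X² − X + 1`** (characteristic zero).
[folklore] -/
theorem isPrimitiveRoot_six_iff {z : K} : IsPrimitiveRoot z 6 ↔ z ^ 2 - z + 1 = 0 :=
  ⟨sq_sub_add_one_eq_zero_of_isPrimitiveRoot_six, isPrimitiveRoot_six_of_sq_sub_add_one_eq_zero⟩

end Field

/-! ### The archimedean characterisation in `ℂ` -/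

/-- For `z ∈ ℂ` with `|z| = 1` and `|1 − z| = 1` one has `Re z = 1/2`
(`|1 − z|² = 2 − 2 Re z` on the unit circle). [folklore] -/
theorem re_eq_half_of_norm_eq_one_of_norm_one_sub_eq_one {z : ℂ} (h1 : ‖z‖ = 1) (h2 : ‖1 - z‖ = 1) :
    z.re = 1 / 2 := by
  have e1 : z.re * z.re + z.im * z.im = 1 := by
    have h := Complex.normSq_eq_norm_sq z
    rw [h1, Complex.normSq_apply] at h
    linarith [h]
  have e2 : (1 - z.re) * (1 - z.re) + z.im * z.im = 1 := by
    have h := Complex.normSq_eq_norm_sq (1 - z)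
    rw [h2, Complex.normSq_apply] at h
    simp only [Complex.sub_re, Complex.one_re, Complex.sub_im, Complex.one_im, zero_sub, mul_neg,
      neg_mul, neg_neg, one_pow] at h
    linarith [h]
  nlinarith [e1, e2]

/-- **`|z| = |1 − z| = 1 ⟹ z² − z + 1 = 0`**: the only points of the unit circle at distance `1` from
`1` are `e^{±iπ/3}`. [folklore] -/
theorem sq_sub_add_one_eq_zero_of_norm {z : ℂ} (h1 : ‖z‖ = 1) (h2 : ‖1 - z‖ = 1) :
    z ^ 2 - z + 1 = 0 := by
  have hre := re_eq_half_of_norm_eq_one_of_norm_one_sub_eq_one h1 h2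
  have e1 : z.re * z.re + z.im * z.im = 1 := by
    have h := Complex.normSq_eq_norm_sq z
    rw [h1, Complex.normSq_apply] at h
    linarith [h]
  have him : z.im * z.im = 3 / 4 := by nlinarith [e1, hre]
  apply Complex.ext
  · simp only [sq, Complex.add_re, Complex.sub_re, Complex.mul_re, Complex.one_re, Complex.zero_re]
    nlinarith [hre, him]
  · simp only [sq, Complex.add_im, Complex.sub_im, Complex.mul_im, Complex.one_im, Complex.zero_im]
    rw [hre]; ring

/-- Conversely a root of `X² − X + 1` in `ℂ` lies on the unit circle at distance `1` from `1`
(`ζ³ = −1` gives `|ζ| = 1`, and `1 − ζ = −ζ²`). [folklore] -/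
theorem norm_eq_one_and_norm_one_sub_eq_one_of_sq_sub_add_one_eq_zero {z : ℂ}
    (h : z ^ 2 - z + 1 = 0) : ‖z‖ = 1 ∧ ‖1 - z‖ = 1 := by
  have h6 := pow_six_eq_one_of_sq_sub_add_one_eq_zero h
  have hn : ‖z‖ = 1 := Complex.norm_eq_one_of_pow_eq_one h6 (by norm_num)
  refine ⟨hn, ?_⟩
  have h1 : 1 - z = -z ^ 2 := by linear_combination h
  rw [h1, norm_neg, norm_pow, hn, one_pow]

/-- **`z² − z + 1 = 0 ⟺ |z| = 1 ∧ |1 − z| = 1`** in `ℂ`. [folklore] -/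
theorem sq_sub_add_one_eq_zero_iff_norm {z : ℂ} :
    z ^ 2 - z + 1 = 0 ↔ ‖z‖ = 1 ∧ ‖1 - z‖ = 1 :=
  ⟨norm_eq_one_and_norm_one_sub_eq_one_of_sq_sub_add_one_eq_zero,
    fun h => sq_sub_add_one_eq_zero_of_norm h.1 h.2⟩

/-- `|z| = |1 − z| = 1 ⟹ z` is a primitive sixth root of unity. [folklore] -/
theorem isPrimitiveRoot_six_of_norm_eq_one_of_norm_one_sub_eq_one {z : ℂ} (h1 : ‖z‖ = 1)
    (h2 : ‖1 - z‖ = 1) : IsPrimitiveRoot z 6 :=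
  isPrimitiveRoot_six_of_sq_sub_add_one_eq_zero (sq_sub_add_one_eq_zero_of_norm h1 h2)

/-! ### Pairwise intersections of the three torsion loci -/

/-- **`T_{0∞} ∩ T_{1∞}`**: if `z` and `1 − z` are both roots of unity in `ℂ`, then `z` is a primitive
sixth root of unity (`z = e^{±iπ/3}`). [folklore] -/
theorem isPrimitiveRoot_six_of_pow_eq_one_of_one_sub_pow_eq_one {z : ℂ} {n m : ℕ} (hn : n ≠ 0)
    (hm : m ≠ 0) (hz : z ^ n = 1) (h1 : (1 - z) ^ m = 1) : IsPrimitiveRoot z 6 :=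
  isPrimitiveRoot_six_of_norm_eq_one_of_norm_one_sub_eq_one (Complex.norm_eq_one_of_pow_eq_one hz hn)
    (Complex.norm_eq_one_of_pow_eq_one h1 hm)

/-- **`T_{0∞} ∩ T_{01}`**: if `z` and `z/(z − 1)` are both roots of unity in `ℂ`, then `z` is a
primitive sixth root of unity. (`z = 1` is excluded automatically: then `z/(z−1) = 0`.) [folklore] -/
theorem isPrimitiveRoot_six_of_pow_eq_one_of_div_pow_eq_one {z : ℂ} {n m : ℕ} (hn : n ≠ 0)
    (hm : m ≠ 0) (hz : z ^ n = 1) (h : (z / (z - 1)) ^ m = 1) : IsPrimitiveRoot z 6 := by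
  have nz : ‖z‖ = 1 := Complex.norm_eq_one_of_pow_eq_one hz hn
  have nw : ‖z / (z - 1)‖ = 1 := Complex.norm_eq_one_of_pow_eq_one h hm
  have hne : z - 1 ≠ 0 := by
    intro h0
    rw [h0, div_zero, zero_pow hm] at h
    exact zero_ne_one h
  have h2 : ‖1 - z‖ = 1 := by
    rw [norm_div, nz, one_div, inv_eq_one] at nw
    rwa [norm_sub_rev]
  exact isPrimitiveRoot_six_of_norm_eq_one_of_norm_one_sub_eq_one nz h2

/-- **`T_{1∞} ∩ T_{01}`**: if `1 − z` and `z/(z − 1)` are both roots of unity in `ℂ`, then `z` is a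
primitive sixth root of unity. [folklore] -/
theorem isPrimitiveRoot_six_of_one_sub_pow_eq_one_of_div_pow_eq_one {z : ℂ} {n m : ℕ} (hn : n ≠ 0)
    (hm : m ≠ 0) (h1 : (1 - z) ^ n = 1) (h : (z / (z - 1)) ^ m = 1) : IsPrimitiveRoot z 6 := by
  have n1 : ‖1 - z‖ = 1 := Complex.norm_eq_one_of_pow_eq_one h1 hn
  have nw : ‖z / (z - 1)‖ = 1 := Complex.norm_eq_one_of_pow_eq_one h hm
  have n1' : ‖z - 1‖ = 1 := by rwa [norm_sub_rev] at n1
  have nz : ‖z‖ = 1 := by rwa [norm_div, n1', div_one] at nw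
  exact isPrimitiveRoot_six_of_norm_eq_one_of_norm_one_sub_eq_one nz n1

/-! ### Versions over a field embedded in `ℂ` (e.g. a number field with a complex embedding) -/

section Embedded

variable {K : Type*} [Field K]

/-- `T_{0∞} ∩ T_{1∞}` over a field `K` with a ring homomorphism `φ : K → ℂ`: `x`, `1 − x` roots of
unity ⟹ `x` is a primitive sixth root of unity in `K`. [folklore] -/
theorem isPrimitiveRoot_six_of_pow_eq_one_of_one_sub_pow_eq_one' (φ : K →+* ℂ) {x : K} {n m : ℕ} (hn : n ≠ 0)
    (hm : m ≠ 0) (hx : x ^ n = 1) (h1 : (1 - x) ^ m = 1) : IsPrimitiveRoot x 6 := by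
  refine IsPrimitiveRoot.of_map_of_injective (f := φ) ?_ φ.injective
  refine isPrimitiveRoot_six_of_pow_eq_one_of_one_sub_pow_eq_one hn hm ?_ ?_
  · rw [← map_pow, hx, map_one]
  · rw [← map_one φ, ← map_sub, ← map_pow, h1, map_one]

/-- `T_{0∞} ∩ T_{01}` over a field `K` with `φ : K → ℂ`: `x`, `x/(x − 1)` roots of unity ⟹ `x` is a
primitive sixth root of unity. [folklore] -/
theorem isPrimitiveRoot_six_of_pow_eq_one_of_div_pow_eq_one' (φ : K →+* ℂ) {x : K} {n m : ℕ} (hn : n ≠ 0)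
    (hm : m ≠ 0) (hx : x ^ n = 1) (h : (x / (x - 1)) ^ m = 1) : IsPrimitiveRoot x 6 := by
  refine IsPrimitiveRoot.of_map_of_injective (f := φ) ?_ φ.injective
  refine isPrimitiveRoot_six_of_pow_eq_one_of_div_pow_eq_one hn hm ?_ ?_
  · rw [← map_pow, hx, map_one]
  · rw [← map_one φ, ← map_sub, ← map_div₀, ← map_pow, h, map_one]

/-- `T_{1∞} ∩ T_{01}` over a field `K` with `φ : K → ℂ`: `1 − x`, `x/(x − 1)` roots of unity ⟹ `x` is a
primitive sixth root of unity. [folklore] -/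
theorem isPrimitiveRoot_six_of_one_sub_pow_eq_one_of_div_pow_eq_one' (φ : K →+* ℂ)
    {x : K} {n m : ℕ} (hn : n ≠ 0)
    (hm : m ≠ 0) (h1 : (1 - x) ^ n = 1) (h : (x / (x - 1)) ^ m = 1) : IsPrimitiveRoot x 6 := by
  refine IsPrimitiveRoot.of_map_of_injective (f := φ) ?_ φ.injective
  refine isPrimitiveRoot_six_of_one_sub_pow_eq_one_of_div_pow_eq_one hn hm ?_ ?_
  · rw [← map_one φ, ← map_sub, ← map_pow, h1, map_one]
  · rw [← map_one φ, ← map_sub, ← map_div₀, ← map_pow, h, map_one]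

end Embedded

/-! ### Real roots of unity -/

/-- A root of unity in `ℂ` which is real is `1` or `−1` (the input "a torsion point lying in a real
chart interval is `±1`" of the power/Chebyshev slot count). [folklore] -/
theorem eq_one_or_eq_neg_one_of_pow_eq_one_of_im_eq_zero {z : ℂ} {n : ℕ} (hn : n ≠ 0)
    (hz : z ^ n = 1) (him : z.im = 0) : z = 1 ∨ z = -1 := by
  have hnorm : ‖z‖ = 1 := Complex.norm_eq_one_of_pow_eq_one hz hn
  have e1 : z.re * z.re = 1 := by
    have h := Complex.normSq_eq_norm_sq z
    rw [hnorm, Complex.normSq_apply, him] at h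
    linarith [h]
  have hre : z.re = 1 ∨ z.re = -1 := by
    have : (z.re - 1) * (z.re + 1) = 0 := by linear_combination e1
    rcases mul_eq_zero.mp this with h0 | h0
    · left; linarith
    · right; linarith
  rcases hre with h0 | h0
  · left
    apply Complex.ext <;> simp [h0, him]
  · right
    apply Complex.ext <;> simp [h0, him]

/-- S6's phrasing of the power/Chebyshev slot input ("`4ζ − 2 ∈ [−2,2] ⇒ ζ = ±1`"): a root of unity
`ζ` whose image `4ζ − 2` under the affine chart `z ↦ 4z − 2` (cusps `0, 1 ↦ −2, 2`) is REAL is `±1`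
(so among roots of unity only `ζ = 1 ↦ 2` reaches the real interval `[−2, 2]`). [folklore] -/
theorem eq_one_or_eq_neg_one_of_pow_eq_one_of_im_chart_eq_zero {z : ℂ} {n : ℕ} (hn : n ≠ 0)
    (hz : z ^ n = 1) (h : (4 * z - 2).im = 0) : z = 1 ∨ z = -1 := by
  apply eq_one_or_eq_neg_one_of_pow_eq_one_of_im_eq_zero hn hz
  have h' : (4 * z - 2).im = 4 * z.im := by simp [Complex.mul_im]
  linarith [h, h']

/-! ### The Chebyshev torsion values `u + u⁻¹`, `u ∈ μ_∞`, are real and lie in `[−2, 2]` -/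

/-- For `u` on the unit circle, `u⁻¹ = conj u` (Mathlib `Complex.inv_eq_conj`), so `u + u⁻¹ = 2 Re u`
(`Complex.add_conj`) is real: the preperiodic points `ζ + ζ⁻¹` (`ζ ∈ μ_∞`) of the Chebyshev family are
real. [folklore] -/
theorem im_add_inv_eq_zero_of_norm_eq_one {u : ℂ} (hu : ‖u‖ = 1) : (u + u⁻¹).im = 0 := by
  rw [Complex.inv_eq_conj hu, Complex.add_conj, Complex.ofReal_im]

/-- For `u` on the unit circle, `u + u⁻¹ ∈ [−2, 2]` (`|Re u| ≤ |u| = 1`). [folklore] -/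
theorem abs_re_add_inv_le_two_of_norm_eq_one {u : ℂ} (hu : ‖u‖ = 1) : |(u + u⁻¹).re| ≤ 2 := by
  rw [Complex.inv_eq_conj hu, Complex.add_conj, Complex.ofReal_re, abs_mul, abs_two]
  have h := Complex.abs_re_le_norm u
  rw [hu] at h
  linarith

/-- A root of unity `u` with `u + u⁻¹ = 2` is `u = 1`, and with `u + u⁻¹ = −2` is `u = −1`: the
Chebyshev torsion value `±2` is attained only at `u = ±1` (`Re u = ±1` on the unit circle).
[folklore] -/
theorem eq_one_of_norm_eq_one_of_add_inv_eq_two {u : ℂ} (hu : ‖u‖ = 1) (h : u + u⁻¹ = 2) :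
    u = 1 := by
  have hre : u.re = 1 := by
    have h2 := congrArg Complex.re h
    rw [Complex.inv_eq_conj hu, Complex.add_conj, Complex.ofReal_re] at h2
    norm_num at h2
    linarith
  have e1 : u.re * u.re + u.im * u.im = 1 := by
    have h' := Complex.normSq_eq_norm_sq u
    rw [hu, Complex.normSq_apply] at h'
    linarith [h']
  have him : u.im = 0 := by nlinarith [e1, hre]
  apply Complex.ext <;> simp [hre, him]

/-- A point of the unit circle with `u + u⁻¹ = −2` is `u = −1`. [folklore] -/
theorem eq_neg_one_of_norm_eq_one_of_add_inv_eq_neg_two {u : ℂ} (hu : ‖u‖ = 1)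
    (h : u + u⁻¹ = -2) : u = -1 := by
  have hre : u.re = -1 := by
    have h2 := congrArg Complex.re h
    rw [Complex.inv_eq_conj hu, Complex.add_conj, Complex.ofReal_re] at h2
    norm_num at h2
    linarith
  have e1 : u.re * u.re + u.im * u.im = 1 := by
    have h' := Complex.normSq_eq_norm_sq u
    rw [hu, Complex.normSq_apply] at h'
    linarith [h']
  have him : u.im = 0 := by nlinarith [e1, hre]
  apply Complex.ext <;> simp [hre, him]

/-! ### Fresh roots of a non-torsion point are pairwise distinct across exponents -/

section Fresh

variable {K : Type*} [Field K]

/-- Auxiliary form: `b^p = a = b^q` with `p < q` and `a ≠ 0` forces `a^{q−p} = 1`. [folklore] -/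
private theorem pow_sub_eq_one_aux {a b : K} {p q : ℕ} (hb : b ^ p = a) (hc : b ^ q = a)
    (hlt : p < q) (ha0 : a ≠ 0) : a ^ (q - p) = 1 := by
  have hb0 : b ≠ 0 := by
    rintro rfl
    exact ha0 (by rw [← hc, zero_pow (by omega)])
  have h1 : b ^ (q - p) = 1 := by
    have h : b ^ q = b ^ p := hc.trans hb.symm
    rw [← Nat.add_sub_cancel' hlt.le, pow_add] at h
    exact (mul_eq_left₀ (pow_ne_zero _ hb0)).mp h
  rw [← hb, ← pow_mul, mul_comm, pow_mul, h1, one_pow]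

/-- **Fresh roots are distinct across exponents**: if `a ≠ 0` is not a root of unity, then a `p`-th
root and a `q`-th root of `a` with `p ≠ q` never coincide (`b = c` would give `b^{|p−q|} = 1`, hence
`a` torsion) — the input "fresh `p`-th roots … are pairwise distinct across exponents" of the W8
covering lemma (power families `x ↦ x^p`). [folklore] -/
theorem ne_of_pow_eq_of_pow_eq_of_not_isOfFinOrder {a b c : K} {p q : ℕ} (hb : b ^ p = a)
    (hc : c ^ q = a) (hpq : p ≠ q) (ha0 : a ≠ 0) (ha : ∀ n : ℕ, 0 < n → a ^ n ≠ 1) : b ≠ c := by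
  rintro rfl
  rcases Nat.lt_or_gt_of_ne hpq with hlt | hlt
  · exact ha (q - p) (Nat.sub_pos_of_lt hlt) (pow_sub_eq_one_aux hb hc hlt ha0)
  · exact ha (p - q) (Nat.sub_pos_of_lt hlt) (pow_sub_eq_one_aux hc hb hlt ha0)

end Fresh

end GenEllTwo.TorsionLoci

end Summit.ABC.ABC.Theorems
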